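import Mathlib.Analysis.SpecificLimits.Basic
import Summits.CriticalPhenomena.PercolationContinuityZ3.Theorems.PercNearOneGluingNoHeavyLowerTailSunflowerCoverHolder

/-!
# `NoHeavyLowerTail` (crux stmt-CriticalPhenomena-4575), abstract sunflower cubic: THE COVER PROPERTY ⟹ GRADED SAFETY

Support file (seat `prim-ineq-prove-1` gen 36; `--supports stmt-CriticalPhenomena-4575`).  No `sorry`, no named facts.
Memo: run/shared/lean/prim/prim-ineq-prove-1/FINDING-COVER-prove1-g36.md §1–§2.

SETTING (as `…SunflowerLSMGraded`).  `μ = prodBernoulli p`, a block `a`, a finite family `𝒯` of subsets of the block (think: the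
minimal transversals of a core), and for `𝒰 ⊆ 𝒯` the family functional `famIn p a 𝒯 𝒰 = P(every member of 𝒯 inside the missing
set lies in 𝒰)`; `h := famIn p a 𝒯 ∅` is the probability that no member is missed ("good").
* `Cover p a 𝒯` — the **COVER PROPERTY**: for every finite list of sub-families `S k` (`k < K`) in which every member of `𝒯`
  occurs at most `m` times, `∏_k famIn p a 𝒯 (S k) ≤ h ^ (K − m)`.  (`m = 1` is safety of the core, `m = K − 1` is Harris.)
* **`prod_BEx_le_of_cover`** (THEOREM 1 of the memo, capacity version): if `Cover p a 𝒯` and `h > 0`, then for all floors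
  `c ∈ (0,1]`, all `n`, `m` and all antitone `G i : (T ⊆ a) → [c,1]` with `∏_i G i T ≤ c^(n−m)` whenever `T` contains a member of
  `𝒯`: `∏_i BEx p a (G i) ≤ (h + (1−h)c)^(n−m)`.  PROOF: min-type majorant with integer ranks `κ = ⌊N ρ⌋`, `q = c^{1/N}`
  (as in `gsafe_of_lsm`); `q^{maxRank} = ∏_{l<N} q^{[l < maxRank]}` and Hölder (`BEx_prod_le`) give
  `BEx(G i) ≤ ∏_l F(𝒰_{i,l})^{1/N}` with the level families `𝒰_{i,l} = {C : κ_i C ≤ l}`, `F = q^N + (1−q^N)·famIn`; every `C`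
  lies in at most `mN + n` of the `nN` level families, so `Cover` (lifted to the floor `q^N = c` by `prod_affine_le_pow`) bounds
  the product by `(h+(1−h)c)^{(n−m)N−n}`; `N → ∞`.
* **`gsafe_of_cover`** — hence an up-set `A` determined by the block whose bad sets are covered by `𝒯` (all members bad) and
  with `μ A > 0` is GRADEDLY SAFE (`GSafe p a A`), so safe with all the rows of `…SunflowerSafeCalculus`.
-/

noncomputable section

namespace Summit.CriticalPhenomena.PercolationContinuityZ3.Theorems.SunflowerPartition

namespace SafeCalc

open MeasureTheory Finset Filter Topology
open Literature.Probability.LatticeModels Literature.Probability.Percolation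
open TwoGenCore (wmiss)

variable {ι : Type*} [DecidableEq ι] (p : ι → unitInterval) (a : Finset ι)

/-! ## The cover property -/

/-- **The COVER property** of a family `𝒯` on the block `a`: for every list of `K` sub-families in which each member of `𝒯`
occurs at most `m` times, `∏_k famIn p a 𝒯 (S k) ≤ (famIn p a 𝒯 ∅) ^ (K − m)`. [this work] -/
def Cover (𝒯 : Finset (Finset ι)) : Prop :=
  ∀ (K m : ℕ) (S : Fin K → Finset (Finset ι)), (∀ C ∈ 𝒯, (univ.filter fun k => C ∈ S k).card ≤ m) →
    ∏ k, famIn p a 𝒯 (S k) ≤ famIn p a 𝒯 ∅ ^ (K - m)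

/-- The cover property for families indexed by an arbitrary finite type. [this work] -/
theorem Cover.prod_le {𝒯 : Finset (Finset ι)} (h : Cover p a 𝒯) {κ : Type*} [Fintype κ] (m : ℕ)
    (S : κ → Finset (Finset ι)) (hS : ∀ C ∈ 𝒯, (univ.filter fun k => C ∈ S k).card ≤ m) :
    ∏ k, famIn p a 𝒯 (S k) ≤ famIn p a 𝒯 ∅ ^ (Fintype.card κ - m) := by
  classical
  let e := Fintype.equivFin κ
  have hc : ∀ C, (univ.filter fun j : Fin (Fintype.card κ) => C ∈ S (e.symm j)).card =
      (univ.filter fun k => C ∈ S k).card := by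
    intro C
    refine Finset.card_bij (fun j _ => e.symm j) (fun j hj => ?_) (fun j₁ _ j₂ _ h => e.symm.injective h)
      (fun k hk => ⟨e k, ?_, by simp⟩)
    · rw [mem_filter] at hj ⊢; exact ⟨mem_univ _, hj.2⟩
    · rw [mem_filter] at hk ⊢; exact ⟨mem_univ _, by simpa using hk.2⟩
  have h1 := h (Fintype.card κ) m (fun j => S (e.symm j)) (fun C hC => by rw [hc C]; exact hS C hC)
  rw [← Fintype.prod_equiv e.symm (fun j => famIn p a 𝒯 (S (e.symm j))) (fun k => famIn p a 𝒯 (S k)) (fun _ => rfl)]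
  exact h1

/-! ## Theorem 1: the cover property implies graded safety (capacity version) -/

/-- **THEOREM 1 (capacity version): the cover property implies graded safety.**  If `Cover p a 𝒯` and
`h = famIn p a 𝒯 ∅ > 0`, then for every floor `c ∈ (0,1]`, all `n, m` and all antitone `[c,1]`-valued `G i` on the missing sets
of the block with `∏_i G i T ≤ c^(n−m)` whenever `T` contains a member of `𝒯`:
`∏_i BEx p a (G i) ≤ (h + (1−h) c)^(n−m)`. [this work] -/
theorem prod_BEx_le_of_cover (𝒯 : Finset (Finset ι)) (h𝒯a : ∀ C ∈ 𝒯, C ⊆ a) (hcov : Cover p a 𝒯)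
    (hh : 0 < famIn p a 𝒯 ∅) {n m : ℕ} {c : ℝ} (hc : 0 < c) (hc1 : c ≤ 1) (G : Fin n → Finset ι → ℝ)
    (hanti : ∀ i, ∀ T T' : Finset ι, T ⊆ T' → T' ⊆ a → G i T' ≤ G i T)
    (hle1 : ∀ i, ∀ T : Finset ι, T ⊆ a → G i T ≤ 1) (hge : ∀ i, ∀ T : Finset ι, T ⊆ a → c ≤ G i T)
    (hbadG : ∀ T : Finset ι, T ⊆ a → (∃ C ∈ 𝒯, C ⊆ T) → ∏ i, G i T ≤ c ^ (n - m)) :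
    ∏ i, BEx p a (G i) ≤ (famIn p a 𝒯 ∅ + (1 - famIn p a 𝒯 ∅) * c) ^ (n - m) := by
  classical
  set h := famIn p a 𝒯 ∅ with hhdef
  have hh1 : h ≤ 1 := famIn_le_one p a 𝒯 ∅
  set F0 := h + (1 - h) * c with hF0
  have hF0pos : 0 < F0 := by rw [hF0]; nlinarith
  have hF01 : F0 ≤ 1 := by rw [hF0]; nlinarith
  have hGpos : ∀ i T, T ⊆ a → 0 < G i T := fun i T hT => hc.trans_le (hge i T hT)
  have hBEx0 : ∀ i, 0 ≤ BEx p a (G i) := fun i => BEx_nonneg p a fun T hT => (hGpos i T hT).le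
  have hBEx1 : ∀ i, BEx p a (G i) ≤ 1 := fun i =>
    (BEx_mono p a (hle1 i)).trans (le_of_eq (BEx_const p a 1))
  -- trivial cases
  rcases Nat.lt_or_ge m n with hmn | hnm
  swap
  · rw [Nat.sub_eq_zero_of_le hnm, pow_zero]
    exact prod_le_one (fun i _ => hBEx0 i) (fun i _ => hBEx1 i)
  have hnpos : 0 < n := lt_of_le_of_lt (Nat.zero_le m) hmn
  rcases eq_or_lt_of_le hc1 with hceq | hclt
  · have hG1 : ∀ i, BEx p a (G i) = 1 := by
      intro i
      have : BEx p a (G i) = BEx p a (fun _ => 1) :=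
        sum_congr rfl fun T hT => by
          rw [mem_powerset] at hT
          rw [le_antisymm (hle1 i T hT) (hceq ▸ hge i T hT)]
      rw [this, BEx_const]
    rw [prod_congr rfl fun i _ => hG1 i, prod_const_one, hF0, hceq]
    have : h + (1 - h) * 1 = 1 := by ring
    rw [this, one_pow]
  -- main case: for every N with n ≤ (n - m) N
  have key : ∀ N : ℕ, 0 < N → n ≤ (n - m) * N →
      ∏ i, BEx p a (G i) ≤ F0 ^ (((n - m : ℕ) : ℝ) - (n : ℝ) / N) := by
    intro N hN hnN
    have hNr : (0 : ℝ) < N := by exact_mod_cast hN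
    set q : ℝ := c ^ (1 / (N : ℝ)) with hq
    have hq0 : 0 < q := Real.rpow_pos_of_pos hc _
    have hq1 : q ≤ 1 := Real.rpow_le_one hc.le hclt.le (by positivity)
    have hqN : q ^ N = c := by
      rw [hq, ← Real.rpow_natCast, ← Real.rpow_mul hc.le, one_div_mul_cancel hNr.ne', Real.rpow_one]
    -- integer ranks
    let κ' : Fin n → Finset ι → ℕ := fun i C => ⌊(N : ℝ) * rho c (G i C)⌋₊
    let κ : Fin n → ↥𝒯 → ℕ := fun i C => κ' i C
    have hκN : ∀ i C, C ⊆ a → κ' i C ≤ N := by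
      intro i C hC
      refine Nat.floor_le_of_le ?_
      calc (N : ℝ) * rho c (G i C) ≤ (N : ℝ) * 1 :=
            mul_le_mul_of_nonneg_left (rho_le_one hc hclt (hge i C hC)) hNr.le
        _ = N := mul_one _
    have hmaxN : ∀ i T, maxRank 𝒯 (κ i) T ≤ N := by
      intro i T
      unfold maxRank
      rw [Finset.sup_le_iff]
      intro C _
      exact hκN i C (h𝒯a C C.2)
    -- the min-type majorant
    have hmaj : ∀ i T, T ⊆ a → G i T ≤ q ^ maxRank 𝒯 (κ i) T := by
      intro i T hT
      by_cases hne : (univ.filter fun C : ↥𝒯 => (C : Finset ι) ⊆ T).Nonempty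
      · obtain ⟨C, hC, hCeq⟩ := exists_mem_eq_sup _ hne (κ i)
        rw [mem_filter] at hC
        unfold maxRank; rw [hCeq]
        exact (hanti i _ _ hC.2 hT).trans
          (le_q_pow_floor hc hclt hN (hGpos i C (h𝒯a C C.2)) (hle1 i C (h𝒯a C C.2)))
      · rw [Finset.not_nonempty_iff_eq_empty] at hne
        unfold maxRank; rw [hne, sup_empty, bot_eq_zero, pow_zero]
        exact hle1 i T hT
    -- column condition: n + ∑_i κ'_i C ≥ (n - m) N for C ∈ 𝒯
    have hcol : ∀ C ∈ 𝒯, (n - m) * N ≤ n + ∑ i, κ' i C := by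
      intro C hC
      have hCa := h𝒯a C hC
      have hρsum : ((n - m : ℕ) : ℝ) ≤ ∑ i, rho c (G i C) := by
        have hprod := hbadG C hCa ⟨C, hC, subset_rfl⟩
        have hlog : ∑ i, Real.log (G i C) ≤ ((n - m : ℕ) : ℝ) * Real.log c := by
          rw [← Real.log_prod (fun i _ => (hGpos i C hCa).ne'), ← Real.log_pow]
          exact Real.log_le_log (prod_pos fun i _ => hGpos i C hCa) hprod
        have : ∑ i, rho c (G i C) = (∑ i, Real.log (G i C)) / Real.log c := by
          unfold rho; rw [sum_div]
        rw [this, le_div_iff_of_neg (log_c_neg hc hclt)]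
        linarith
      have hfl : ∀ i, (N : ℝ) * rho c (G i C) - 1 ≤ (κ' i C : ℝ) := fun i => (Nat.sub_one_lt_floor _).le
      have hR : ((n - m : ℕ) : ℝ) * N - n ≤ ∑ i, (κ' i C : ℝ) := by
        have h1 := sum_le_sum fun i (_ : i ∈ (univ : Finset (Fin n))) => hfl i
        rw [sum_sub_distrib, sum_const, card_univ, Fintype.card_fin, nsmul_eq_mul, mul_one, ← mul_sum] at h1
        nlinarith [mul_le_mul_of_nonneg_left hρsum hNr.le]
      have hgoal : (((n - m) * N : ℕ) : ℝ) ≤ ((n + ∑ i, κ' i C : ℕ) : ℝ) := by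
        push_cast
        linarith
      exact_mod_cast hgoal
    -- level families
    let 𝒰 : Fin n × Fin N → Finset (Finset ι) := fun il => 𝒯.filter fun C => κ' il.1 C ≤ (il.2 : ℕ)
    have hmult : ∀ C ∈ 𝒯, (univ.filter fun il : Fin n × Fin N => C ∈ 𝒰 il).card ≤ m * N + n := by
      intro C hC
      have hcount : (univ.filter fun il : Fin n × Fin N => C ∈ 𝒰 il).card = ∑ i, (N - κ' i C) := by
        have h1 : (univ.filter fun il : Fin n × Fin N => C ∈ 𝒰 il) =
            univ.filter fun il : Fin n × Fin N => κ' il.1 C ≤ (il.2 : ℕ) := by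
          ext il
          simp only [mem_filter, mem_univ, true_and, 𝒰, hC]
        rw [h1, card_filter, Fintype.sum_prod_type]
        refine sum_congr rfl fun i _ => ?_
        rw [← card_filter]
        exact card_filter_le_val (N := N) (k := κ' i C)
      rw [hcount]
      -- ∑ (N - κ) = n N - ∑ κ ≤ m N + n
      have h2 : ∑ i, (N - κ' i C) + ∑ i, κ' i C = n * N := by
        rw [← sum_add_distrib, sum_congr rfl fun i _ => Nat.sub_add_cancel (hκN i C (h𝒯a C hC)), sum_const,
          card_univ, Fintype.card_fin, smul_eq_mul]
      have h3 := hcol C hC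
      have h4 : (n - m) * N = n * N - m * N := Nat.sub_mul n m N
      omega
    -- Hölder per player
    have hq_pow_pos : 0 < q ^ N := pow_pos hq0 N
    let Fq : Finset (Finset ι) → ℝ := fun 𝒱 => q ^ N + (1 - q ^ N) * famIn p a 𝒯 𝒱
    have hplayer : ∀ i, BEx p a (G i) ≤ ∏ l : Fin N, Fq (𝒰 (i, l)) ^ ((N : ℝ)⁻¹) := by
      intro i
      let Y : Fin N → Finset ι → ℝ := fun l T => if (l : ℕ) < maxRank 𝒯 (κ i) T then q else 1
      have hY0 : ∀ l T, T ⊆ a → 0 ≤ Y l T := fun l T _ => by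
        dsimp only [Y]; split_ifs; exacts [hq0.le, zero_le_one]
      have hYN : ∀ l T, Y l T ^ N = q ^ N + (1 - q ^ N) *
          (if ∀ C ∈ 𝒯, C ⊆ T → C ∈ 𝒰 (i, l) then (1 : ℝ) else 0) := by
        intro l T
        have hiff : (∀ C ∈ 𝒯, C ⊆ T → C ∈ 𝒰 (i, l)) ↔ maxRank 𝒯 (κ i) T ≤ (l : ℕ) := by
          unfold maxRank
          rw [Finset.sup_le_iff]
          constructor
          · intro hall C hC
            rw [mem_filter] at hC
            have := hall C C.2 hC.2
            simp only [𝒰, mem_filter] at this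
            exact this.2
          · intro hall C hC hCT
            simp only [𝒰, mem_filter]
            exact ⟨hC, hall ⟨C, hC⟩ (by rw [mem_filter]; exact ⟨mem_univ _, hCT⟩)⟩
        dsimp only [Y]
        by_cases hlt : (l : ℕ) < maxRank 𝒯 (κ i) T
        · rw [if_pos hlt, if_neg (fun hall => absurd (hiff.1 hall) (not_le.2 hlt))]; ring
        · rw [if_neg hlt, if_pos (hiff.2 (not_lt.1 hlt)), one_pow]; ring
      have hBExYN : ∀ l, BEx p a (fun T => Y l T ^ N) = Fq (𝒰 (i, l)) := by
        intro l
        simp only [hYN]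
        rw [BEx_affine]
        rfl
      have hposl : ∀ l, 0 < BEx p a (fun T => Y l T ^ N) := by
        intro l
        rw [hBExYN]
        dsimp only [Fq]
        nlinarith [famIn_nonneg p a 𝒯 (𝒰 (i, l)), pow_le_one₀ hq0.le hq1 (n := N)]
      calc BEx p a (G i) ≤ BEx p a (fun T => q ^ maxRank 𝒯 (κ i) T) := BEx_mono p a (hmaj i)
        _ = BEx p a (fun T => ∏ l, Y l T) :=
            sum_congr rfl fun T _ => by dsimp only; rw [pow_eq_prod_ite (hmaxN i T) q]
        _ ≤ ∏ l, BEx p a (fun T => Y l T ^ N) ^ ((N : ℝ)⁻¹) := BEx_prod_le p a hN.ne' Y hY0 hposl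
        _ = ∏ l, Fq (𝒰 (i, l)) ^ ((N : ℝ)⁻¹) := prod_congr rfl fun l _ => by rw [hBExYN]
    -- Cover, lifted to the floor q^N = c
    have hmNn : m * N + n ≤ n * N := by
      have h4 : (n - m) * N = n * N - m * N := Nat.sub_mul n m N
      omega
    have hcover0 := hcov.prod_le p a (m * N + n) 𝒰 hmult
    rw [Fintype.card_prod, Fintype.card_fin, Fintype.card_fin] at hcover0
    have hlift : ∏ il, Fq (𝒰 il) ≤ F0 ^ (n * N - (m * N + n)) := by
      have := prod_affine_le_pow (x := fun il => famIn p a 𝒯 (𝒰 il)) (c := q ^ N) (t := n * N - (m * N + n))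
        hh hh1 hq_pow_pos.le (pow_le_one₀ hq0.le hq1) (fun il => famIn_mono p a 𝒯 (empty_subset _))
        (fun il => famIn_le_one p a 𝒯 _) hcover0
      rw [hqN] at this
      have hF0' : c + (1 - c) * h = F0 := by rw [hF0]; ring
      rw [hF0'] at this
      simpa only [Fq, hqN] using this
    -- assemble
    have hFq0 : ∀ il, 0 ≤ Fq (𝒰 il) := fun il => by
      dsimp only [Fq]; nlinarith [famIn_nonneg p a 𝒯 (𝒰 il), pow_le_one₀ hq0.le hq1 (n := N)]
    have hexp : (((n * N - (m * N + n) : ℕ) : ℝ)) * (N : ℝ)⁻¹ = ((n - m : ℕ) : ℝ) - (n : ℝ) / N := by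
      rw [Nat.cast_sub hmNn, Nat.cast_sub hmn.le]
      push_cast
      field_simp
      ring
    calc ∏ i, BEx p a (G i) ≤ ∏ i, ∏ l : Fin N, Fq (𝒰 (i, l)) ^ ((N : ℝ)⁻¹) :=
          prod_le_prod (fun i _ => hBEx0 i) (fun i _ => hplayer i)
      _ = ∏ il : Fin n × Fin N, Fq (𝒰 il) ^ ((N : ℝ)⁻¹) := (Fintype.prod_prod_type' _).symm
      _ = (∏ il : Fin n × Fin N, Fq (𝒰 il)) ^ ((N : ℝ)⁻¹) := Real.finsetProd_rpow _ _ (fun il _ => hFq0 il) _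
      _ ≤ (F0 ^ (n * N - (m * N + n))) ^ ((N : ℝ)⁻¹) :=
          Real.rpow_le_rpow (prod_nonneg fun il _ => hFq0 il) hlift (by positivity)
      _ = F0 ^ (((n - m : ℕ) : ℝ) - (n : ℝ) / N) := by
          rw [← Real.rpow_natCast, ← Real.rpow_mul hF0pos.le, hexp]
  -- N → ∞
  have hlim : Tendsto (fun N : ℕ => F0 ^ (((n - m : ℕ) : ℝ) - (n : ℝ) / N)) atTop (𝓝 (F0 ^ (((n - m : ℕ) : ℝ)))) := by
    have h1 : Tendsto (fun N : ℕ => ((n - m : ℕ) : ℝ) - (n : ℝ) / N) atTop (𝓝 (((n - m : ℕ) : ℝ) - 0)) :=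
      tendsto_const_nhds.sub (tendsto_const_div_atTop_nhds_zero_nat (n : ℝ))
    rw [sub_zero] at h1
    exact ((Real.continuous_const_rpow hF0pos.ne').tendsto _).comp h1
  rw [Real.rpow_natCast] at hlim
  refine ge_of_tendsto hlim ?_
  rw [eventually_atTop]
  refine ⟨n, fun N hN => key N (lt_of_lt_of_le hnpos hN) ?_⟩
  calc n = 1 * n := (one_mul n).symm
    _ ≤ (n - m) * N := Nat.mul_le_mul (by omega) hN

/-- **The cover property implies graded safety.**  Let `A` be an up-set determined by the block `a` with `μ A > 0`, and `𝒯` a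
family of bad subsets of the block covering every bad missing set.  If `Cover p a 𝒯` then `A` is gradedly safe. [this work] -/
theorem gsafe_of_cover [Fintype ι] {A : Set (Set ι)} (hd : DeterminedBy A (↑a : Set ι)) (hu : IsUpperSet A)
    (hA : 0 < (prodBernoulli p).real A) (𝒯 : Finset (Finset ι)) (h𝒯a : ∀ C ∈ 𝒯, C ⊆ a)
    (hbad : ∀ C ∈ 𝒯, ((a \ C : Finset ι) : Set ι) ∉ A)
    (hcov : ∀ T, T ⊆ a → ((a \ T : Finset ι) : Set ι) ∉ A → ∃ C ∈ 𝒯, C ⊆ T) (hC : Cover p a 𝒯) :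
    GSafe p a A := by
  classical
  intro n c hc hc1 G hanti hle1 hge _ hbadG
  have hbad' : ∀ C ∈ 𝒯, ∀ T, T ⊆ a → C ⊆ T → ((a \ T : Finset ι) : Set ι) ∉ A := by
    intro C hC T hT hCT hTA
    refine hbad C hC (hu ?_ hTA)
    intro e he
    rw [Finset.mem_coe, Finset.mem_sdiff] at he ⊢
    exact ⟨he.1, fun h => he.2 (hCT h)⟩
  have hh : famIn p a 𝒯 ∅ = (prodBernoulli p).real A := famIn_empty p a hd 𝒯 hbad' hcov
  have key := prod_BEx_le_of_cover p a 𝒯 h𝒯a hC (hh ▸ hA) (m := 1) hc hc1 G hanti hle1 hge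
    (fun T hT ⟨C, hC, hCT⟩ => hbadG T hT (hbad' C hC T hT hCT))
  rw [hh] at key
  exact key

end SafeCalc

end Summit.CriticalPhenomena.PercolationContinuityZ3.Theorems.SunflowerPartition
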